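import Literature.NumberTheory.Automorphic.LocalSchwartzBruhatDirectSum
import Literature.NumberTheory.Automorphic.SchwartzBruhatL2Norm
import Mathlib.MeasureTheory.Constructions.Pi
import Mathlib.MeasureTheory.Measure.Prod
import Mathlib.MeasureTheory.Integral.Lebesgue.Map
import HarnessLib

/-!
# The `L²` norm of a product `f₁ ⊠ f₂` of Schwartz–Bruhat functions; stripping an isometry off a tensor factor

Topic `NumberTheory/Automorphic`; namespace `Literature.NumberTheory.Automorphic`.  KERNEL ONLY: theorems; no definition,
no named fact, no `sorry`.  Sequel of `LocalSchwartzBruhatDirectSum.lean` (`𝒮(K^{ι₁}) ⊗ 𝒮(K^{ι₂}) ≅ 𝒮(K^ι)` along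
`e : ι₁ ⊕ ι₂ ≃ ι`, products `f₁ ⊠ f₂`) and `SchwartzBruhatL2Norm.lean` (`‖Φ‖²_{L²(ν)}` on `𝒮(X)`).

For a non-archimedean local field `K`, a σ-finite measure `μ` on `K` (e.g. a Haar measure) and the product measures
`μ^ι = Measure.pi (fun _ => μ)`:

* §1 **`l2NormSq_boxSB`** — `‖f₁ ⊠ f₂‖²_{L²(μ^ι)} = ‖f₁‖²_{L²(μ^{ι₁})} · ‖f₂‖²_{L²(μ^{ι₂})}` (Tonelli along the
  measure-preserving regrouping `K^ι ≃ K^{ι₁} × K^{ι₂}`; [WeilBNT1967, Chap. VII §2 Prop. 2]: functions on a product);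
* §2 **`l2NormSq_eq_of_boxSB`** — STRIPPING: if an `L²(μ^ι)`-norm-preserving map `A` of `𝒮(K^ι)` acts on products with
  a fixed non-zero second factor `f₂` as `A(f₁ ⊠ f₂) = B(f₁) ⊠ f₂`, then `B` preserves `‖·‖²_{L²(μ^{ι₁})}` (`μ` a Haar
  measure, so that `0 < ‖f₂‖² < ∞`).  [MoeglinVignerasWaldspurger1987, Chap. 2 II.1 Rem. (6)]: an operator on `S₁ ⊗ S₂`
  commuting with the second Heisenberg group is `M₁ ⊗ 1`; here: if it is unitary, so is `M₁`.

Use (Hodge/COR-CM cell, GR-1 Track 2): the local Weil representation of an UNDOUBLED unitary group is obtained by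
stripping, `ω(s(g ⊕ 1))(f₁ ⊠ f₂) = ω(undoubleLoc s g) f₁ ⊠ f₂` (`GelbartRogawski1991/LocalUnitaryUndoubling.lean`); by §2
it is `L²`-isometric as soon as the doubled one is.  Nothing is cited as a hypothesis.

## References
* [WeilBNT1967] A. Weil, *Basic Number Theory* (1967), Chap. VII §2, Prop. 2.
* [MoeglinVignerasWaldspurger1987] C. Mœglin, M.-F. Vignéras, J.-L. Waldspurger, LNM 1291 (1987), Chap. 2 II.1 Rem. (6).
-/

set_option autoImplicit false

noncomputable section

open _root_.MeasureTheory _root_.MeasureTheory.Measure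
open scoped ENNReal

namespace Literature.NumberTheory.Automorphic

open Literature.NumberTheory.GaloisRepresentations.IsNonarchimedeanLocalField

/-! ## §1 `‖f₁ ⊠ f₂‖² = ‖f₁‖² ‖f₂‖²` -/

section Regroup

variable (K : Type*) [MeasurableSpace K] {ι₁ ι₂ ι : Type*} (e : ι₁ ⊕ ι₂ ≃ ι)

/-- the regrouping `v ↦ (v|ι₁, v|ι₂)`, `K^ι → K^{ι₁} × K^{ι₂}`, is the composite of Mathlib's measurable equivalences
`(piCongrLeft e).symm` and `sumPiEquivProdPi`. [folklore] -/
private theorem resL_resR_eq (v : ι → K) :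
    (resL e v, resR e v) =
      (MeasurableEquiv.sumPiEquivProdPi fun _ : ι₁ ⊕ ι₂ => K)
        ((MeasurableEquiv.piCongrLeft (fun _ : ι => K) e).symm v) := by
  refine Prod.ext (funext fun i => ?_) (funext fun j => ?_)
  · change v (e (Sum.inl i)) = (Equiv.piCongrLeft (fun _ : ι => K) e).symm v (Sum.inl i)
    rw [Equiv.piCongrLeft_symm_apply]
  · change v (e (Sum.inr j)) = (Equiv.piCongrLeft (fun _ : ι => K) e).symm v (Sum.inr j)
    rw [Equiv.piCongrLeft_symm_apply]

/-- the regrouping is a measurable embedding (it is a measurable equivalence). [folklore] -/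
private theorem measurableEmbedding_resL_resR :
    MeasurableEmbedding (fun v : ι → K => (resL e v, resR e v)) := by
  have hfun : (fun v : ι → K => (resL e v, resR e v)) =
      ((MeasurableEquiv.piCongrLeft (fun _ : ι => K) e).symm.trans
        (MeasurableEquiv.sumPiEquivProdPi fun _ : ι₁ ⊕ ι₂ => K)) :=
    funext fun v => resL_resR_eq K e v
  rw [hfun]
  exact MeasurableEquiv.measurableEmbedding _

variable [Fintype ι₁] [Fintype ι₂] [Fintype ι] (μ : Measure K) [SigmaFinite μ]

/-- the regrouping is measure preserving for the product measures `μ^ι → μ^{ι₁} × μ^{ι₂}`. [folklore] -/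
private theorem measurePreserving_resL_resR :
    MeasurePreserving (fun v : ι → K => (resL e v, resR e v)) (Measure.pi fun _ : ι => μ)
      ((Measure.pi fun _ : ι₁ => μ).prod (Measure.pi fun _ : ι₂ => μ)) := by
  have h1 : MeasurePreserving (MeasurableEquiv.piCongrLeft (fun _ : ι => K) e).symm (Measure.pi fun _ : ι => μ)
      (Measure.pi fun _ : ι₁ ⊕ ι₂ => μ) :=
    (measurePreserving_piCongrLeft (fun _ : ι => μ) e).symm _
  have h2 : MeasurePreserving (MeasurableEquiv.sumPiEquivProdPi fun _ : ι₁ ⊕ ι₂ => K)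
      (Measure.pi fun _ : ι₁ ⊕ ι₂ => μ) ((Measure.pi fun _ : ι₁ => μ).prod (Measure.pi fun _ : ι₂ => μ)) :=
    measurePreserving_sumPiEquivProdPi fun _ : ι₁ ⊕ ι₂ => μ
  have hfun : (fun v : ι → K => (resL e v, resR e v)) =
      (MeasurableEquiv.sumPiEquivProdPi fun _ : ι₁ ⊕ ι₂ => K) ∘
        (MeasurableEquiv.piCongrLeft (fun _ : ι => K) e).symm :=
    funext fun v => resL_resR_eq K e v
  rw [hfun]
  exact h2.comp h1

end Regroup

section Measurable

variable {X : Type*} [TopologicalSpace X] [MeasurableSpace X] [OpensMeasurableSpace X]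

/-- a Schwartz–Bruhat function on a space whose open sets are measurable gives a measurable `|f|²`. [folklore] -/
private theorem aemeasurable_enorm_sq (f : SchwartzBruhat X) (ν : Measure X) :
    AEMeasurable (fun a => ‖(f : X → ℂ) a‖ₑ ^ 2) ν :=
  ((f.2.1.continuous.measurable.enorm).pow_const 2).aemeasurable

end Measurable

section Product

variable (K : Type*) [Field K] [ValuativeRel K] [TopologicalSpace K] [IsNonarchimedeanLocalField K]
  [MeasurableSpace K] [BorelSpace K] (μ : Measure K) [SigmaFinite μ]
  {ι₁ ι₂ ι : Type*} [Fintype ι₁] [Fintype ι₂] [Fintype ι] (e : ι₁ ⊕ ι₂ ≃ ι)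

/-- **`‖f₁ ⊠ f₂‖²_{L²(μ^ι)} = ‖f₁‖²_{L²(μ^{ι₁})} · ‖f₂‖²_{L²(μ^{ι₂})}`** — `|f₁(v|ι₁) f₂(v|ι₂)|² = |f₁|²(v|ι₁) |f₂|²(v|ι₂)`,
the regrouping `v ↦ (v|ι₁, v|ι₂)` carries `μ^ι` to `μ^{ι₁} × μ^{ι₂}`, and Tonelli.
[cite: WeilBNT1967, Chap. VII §2, Prop. 2] -/
theorem l2NormSq_boxSB (f₁ : SchwartzBruhat (ι₁ → K)) (f₂ : SchwartzBruhat (ι₂ → K)) :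
    SchwartzBruhat.l2NormSq (Measure.pi fun _ : ι => μ) (boxSB K e f₁ f₂) =
      SchwartzBruhat.l2NormSq (Measure.pi fun _ : ι₁ => μ) f₁ *
        SchwartzBruhat.l2NormSq (Measure.pi fun _ : ι₂ => μ) f₂ := by
  haveI : SecondCountableTopology K := secondCountableTopology_localField K
  rw [SchwartzBruhat.l2NormSq_def, SchwartzBruhat.l2NormSq_def, SchwartzBruhat.l2NormSq_def]
  have hint : (fun v : ι → K => ‖((boxSB K e f₁ f₂ : SchwartzBruhat (ι → K)) : (ι → K) → ℂ) v‖ₑ ^ 2) =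
      fun v => (fun p : (ι₁ → K) × (ι₂ → K) =>
        ‖(f₁ : (ι₁ → K) → ℂ) p.1‖ₑ ^ 2 * ‖(f₂ : (ι₂ → K) → ℂ) p.2‖ₑ ^ 2) (resL e v, resR e v) := by
    funext v
    rw [coe_boxSB, enorm_mul, mul_pow]
  have hT := (measurePreserving_resL_resR K e μ).lintegral_comp_emb (measurableEmbedding_resL_resR K e)
    (fun p : (ι₁ → K) × (ι₂ → K) => ‖(f₁ : (ι₁ → K) → ℂ) p.1‖ₑ ^ 2 * ‖(f₂ : (ι₂ → K) → ℂ) p.2‖ₑ ^ 2)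
  rw [hint, hT]
  exact lintegral_prod_mul (aemeasurable_enorm_sq f₁ _) (aemeasurable_enorm_sq f₂ _)

end Product

/-! ## §2 Stripping an `L²`-isometry off a tensor factor -/

section Strip

variable (K : Type*) [Field K] [ValuativeRel K] [TopologicalSpace K] [IsNonarchimedeanLocalField K]
  [MeasurableSpace K] [BorelSpace K] (μ : Measure K) [μ.IsAddHaarMeasure]
  {ι₁ ι₂ ι : Type*} [Fintype ι₁] [Fintype ι₂] [Fintype ι] (e : ι₁ ⊕ ι₂ ≃ ι)

/-- **STRIPPING an isometry**: let `A : 𝒮(K^ι) → 𝒮(K^ι)` preserve `‖·‖²_{L²(μ^ι)}` and act on products with the fixed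
non-zero factor `f₂` as `A(f₁ ⊠ f₂) = B(f₁) ⊠ f₂`; then `B` preserves `‖·‖²_{L²(μ^{ι₁})}` — `‖B f₁‖² ‖f₂‖² =
‖A(f₁ ⊠ f₂)‖² = ‖f₁ ⊠ f₂‖² = ‖f₁‖² ‖f₂‖²` and `0 < ‖f₂‖² < ∞` (`μ` a Haar measure).  The unitary case of «an operator on
`S₁ ⊗ S₂` commuting with the second Heisenberg group comes from `S₁`». [cite: MoeglinVignerasWaldspurger1987, Chap. 2 II.1 Rem. (6)] -/
theorem l2NormSq_eq_of_boxSB (A : SchwartzBruhat (ι → K) → SchwartzBruhat (ι → K))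
    (hA : ∀ Φ, SchwartzBruhat.l2NormSq (Measure.pi fun _ : ι => μ) (A Φ) =
      SchwartzBruhat.l2NormSq (Measure.pi fun _ : ι => μ) Φ)
    (B : SchwartzBruhat (ι₁ → K) → SchwartzBruhat (ι₁ → K)) {f₂ : SchwartzBruhat (ι₂ → K)} (hf₂ : f₂ ≠ 0)
    (hAB : ∀ f₁, A (boxSB K e f₁ f₂) = boxSB K e (B f₁) f₂) (f₁ : SchwartzBruhat (ι₁ → K)) :
    SchwartzBruhat.l2NormSq (Measure.pi fun _ : ι₁ => μ) (B f₁) =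
      SchwartzBruhat.l2NormSq (Measure.pi fun _ : ι₁ => μ) f₁ := by
  haveI : SecondCountableTopology K := secondCountableTopology_localField K
  have h := hA (boxSB K e f₁ f₂)
  rw [hAB, l2NormSq_boxSB, l2NormSq_boxSB] at h
  have h0 : SchwartzBruhat.l2NormSq (Measure.pi fun _ : ι₂ => μ) f₂ ≠ 0 :=
    (SchwartzBruhat.l2NormSq_pos (Measure.pi fun _ : ι₂ => μ) hf₂).ne'
  have htop : SchwartzBruhat.l2NormSq (Measure.pi fun _ : ι₂ => μ) f₂ ≠ ∞ :=
    SchwartzBruhat.l2NormSq_ne_top (Measure.pi fun _ : ι₂ => μ) f₂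
  exact (ENNReal.mul_left_inj h0 htop).1 h

/-- the same for linear maps (the shape `ω(s(g ⊕ 1))(f₁ ⊠ f₂) = ω(g) f₁ ⊠ f₂` of the undoubling).
[cite: MoeglinVignerasWaldspurger1987, Chap. 2 II.1 Rem. (6)] -/
theorem l2NormSq_eq_of_boxSB_linear (A : SchwartzBruhat (ι → K) →ₗ[ℂ] SchwartzBruhat (ι → K))
    (hA : ∀ Φ, SchwartzBruhat.l2NormSq (Measure.pi fun _ : ι => μ) (A Φ) =
      SchwartzBruhat.l2NormSq (Measure.pi fun _ : ι => μ) Φ)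
    (B : SchwartzBruhat (ι₁ → K) →ₗ[ℂ] SchwartzBruhat (ι₁ → K)) {f₂ : SchwartzBruhat (ι₂ → K)} (hf₂ : f₂ ≠ 0)
    (hAB : ∀ f₁, A (boxSB K e f₁ f₂) = boxSB K e (B f₁) f₂) (f₁ : SchwartzBruhat (ι₁ → K)) :
    SchwartzBruhat.l2NormSq (Measure.pi fun _ : ι₁ => μ) (B f₁) =
      SchwartzBruhat.l2NormSq (Measure.pi fun _ : ι₁ => μ) f₁ :=
  l2NormSq_eq_of_boxSB K μ e A hA B hf₂ hAB f₁

end Strip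

end Literature.NumberTheory.Automorphic

end
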